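import Summits.QuantumFields.YangMills.Theorems.BalabanUVNodesN12ChartBRestrict
import Summits.QuantumFields.YangMills.Theorems.BalabanUVNodesN12DirectSurjHsurjProxies
import HarnessLib

/-!
# BalabanUVNodes ∕ N12 — THE (P4)′ RIGHT-INVERSE SOCKET (PROXIES EDITION, ℓ²(HS) LETTER) AT PRINT's DATUM `lamBondsSeq (maxDomT M₁ Z) k` ([II] (2.3)), BY RESTRICTION from the
# (b)-datum socket `…N12DirectSurjHsurjProxies.exists_rightInverse_letter_of_proxies` through this seat's `…N12ChartBRestrict` brick — the O2 (R)-adapter dag-n12-d NAMED for its L2ᴮ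
# (pub-ymgap INBOX 2026-08-30, [DAGN12D-G32 on O1] «On O2 — L2ᴮ's SOCKET, NAMED»)

[Balaban1984PropagatorsII] = «[II]», (2.3) p. 224 (print's `Λ_j` as the DIFFERENCE of the bond sets: fewer constrained bonds than reading (b)); [Balaban1985Variational] = «[15]», Sect. C
(44)–(48) p. 285, (82)–(83) p. 290, (153) p. 301; [Balaban1988Convergent] = «[III]», (2.2) p. 255, (2.10)–(2.13) pp. 256–257; [Balaban1989LargeFieldII] («[IV]») Prop. 1 p. 194 being the
consumer.

Cell `pub-ymgap` (HUMAN RULINGS D-0062 ∕ D-0149), WIDTH SEAT `pub-ymgap-dag-n12-w6` g25 (node N12 = [B15]; key K1⁹ `stmt-QuantumFields-27364`, `--kind proof --supports … --as helper`;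
count-neutral).  THEOREMS ONLY (0 `def`, 0 `instance`, 0 `sorry`); linear algebra over landed kernel theorems: this seat's g7 `…DirectSurjHsurjProxies.exists_rightInverse_letter_of_proxies`
(p678596, the (b)-datum socket: ∃ ε per height, ∃ B per `(M₁, Z)`, ∀ instance, (b)-fibre base point + tower ∕ site proxies + plaquette letter ⟹ right inverse with `√(Σ_b ‖H v b‖²) ≤ B‖v‖`),
g7's ρ5c `…DirectSurjHsurjProxiesPrelim.differentiableAt_msChart_of_towerProxies` (the (b)-chart is differentiable at the base point from the SAME proxies), and g24's brick `…N12ChartBRestrict`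
(`exists_rowMap_of_le`, `exists_rightInverse_of_rowMap`; F0a `lamBondsSeq_subset_bondsDet`).  Imports green (no `Record13*`).  Namespace per dag-n12-d's (i): `…<Parent>Lam`, the parent's
short name kept for the print edition.

WHY.  dag-n12-d's L2ᴮ (`…Prop1DirectOfClassOnlyRowL1NearRadiusDatumScaleAtLength` at print's datum) keys the (P4)′ row on a right inverse of the derivative of PRINT's chart
`msChartB … (lamBondsSeq (maxDomT M₁ Z) k) W U₀` with the ℓ²(HS) letter.  Every print row IS a (b)-row of the same bond (`msChartB_apply`), and the base point of the direct road lies on the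
(b)-fibre where the (b)-chart is differentiable, so the (b)-socket's `H` restricted along the row map (small target vector extended by zero, `‖v'‖ ≤ ‖v‖`) IS the print socket with the SAME
`ε` and the SAME `B` (⚑ LOCATED-RESTRICT).  §4 adds the PRINT-FIBRE edition: a base point with `AgreeOnB (lamBondsSeq …) (M˙U₀) W` (what `IsMinimizerB … (lamBondsSeq …)` delivers) is put on
the (b)-fibre of the spliced datum `W' := W` on print's bonds, `M˙U₀` elsewhere; print's chart does not read `W` off print's bonds (`msChartB_congr_datum`), and the proxies ∕ plaquette rows
do not read `W` at all.

CONTENTS (namespace `Summit.QuantumFields.YangMills.BalabanUVNodes.N12DirectSurjHsurjProxiesLam`): §1 `norm_eq_of_extension`, ★ `exists_rightInverse_l2_of_le`, ★ `exists_rightInverse_sup_l2_of_le` (generic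
`𝔅 ≤ 𝔅'`), `exists_rightInverse_l2_lamBondsSeq_of_genSet` (print ≤ (b), any `Ω`); §2 `msChartB_congr_datum`, `exists_datum_agreeOn_of_agreeOnB`; §3 ★★★ `exists_rightInverse_letter_of_proxies`
(= p678596 binder-for-binder, conclusion over `msChartB … (lamBondsSeq (maxDomT M₁ Z) k)` and `constrCardB`; SAME ε, SAME B); §4 ★★★ `exists_rightInverse_letter_of_proxies_of_agreeOnB`
(the base-point row in print currency).

HONEST FRAMING.  A transfer by name (linear algebra + chain rule); per-height ∕ per-`(M₁, Z)` EXISTENCE letters (volume-dependent `B`; print's (46)∕(83) volume-uniform `O(1)` NOT claimed);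
nothing about existence ∕ minimality over print's larger class (FLAG №16's content untouched); nothing of Bałaban's estimates asserted or refuted; count-neutral helper; N12 NOT discharged;
K0⁷∕K1⁹ NOT closed; counts of record unmoved; one finite 𝕋⁴ programme at fixed ε — R4 closes the conditional rung `BalabanLadder.UV` only; the Yang–Mills mass gap (Clay) is NOT proved by
any of this; nothing continuum ∕ ℝ⁴ ∕ OS.
-/

open scoped BigOperators Matrix.Norms.L2Operator Topology NNReal

namespace Summit.QuantumFields.YangMills.BalabanUVNodes.N12DirectSurjHsurjProxiesLam

open Literature.MathematicalPhysics.QuantumFieldTheory.Balaban1983to89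
open Node00 B15DeterminingSets B15DeterminingSetsB
open T4Continuum (T4Family)
open T4AdjointCovarianceUnitary (lieSU)
open B14.Eq213DetSet (Bj maxDomT)
open B14.Eq213MaximalDomains (side)
open B14.Eq216Concrete (feeds)
open B5Eq118OneStroke (iterBlockOf)
open B15Eq112TorusCover (lift)
open T4AxialGaugeSmallField (boxPlaqs)
open Summit.QuantumFields.YangMills.BalabanUVNodes.N12DirectSurjHsurjProxiesPrelim (differentiableAt_msChart_of_towerProxies)
open Summit.QuantumFields.YangMills.BalabanUVNodes.N12ChartBRestrict (exists_rowMap_of_le exists_rightInverse_of_rowMap)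

variable {F : T4Family} {N : ℕ} [NeZero N] {K k : ℕ}

/-! ## §1  Transfer of right inverses with the ℓ²(HS) letter along a sub-datum -/

section Transfer

variable {𝔅 𝔅' : BDetSet (F.P K)} {W : MSField (F.P K) (SU N)} {U : GaugeField (F.P K) 0 (SU N)}

omit [NeZero N] in
/-- The extension by zero along an injective row map PRESERVES the sup norm: `‖v'‖ = ‖v‖` (the brick records `≤`; `≥` holds because every `‖v i‖ = ‖v' (r i)‖`).
[cite: Balaban1988Convergent, (2.2) p.255 (bookkeeping)] -/
theorem norm_eq_of_extension {r : Fin (constrCardB 𝔅 k) → Fin (constrCardB 𝔅' k)} {v : Fin (constrCardB 𝔅 k) → lieSU (Fin N)}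
    {v' : Fin (constrCardB 𝔅' k) → lieSU (Fin N)} (hr : ∀ i, v' (r i) = v i) (hle : ‖v'‖ ≤ ‖v‖) : ‖v'‖ = ‖v‖ :=
  le_antisymm hle ((pi_norm_le_iff_of_nonneg (norm_nonneg v')).2 fun i => by rw [← hr i]; exact norm_le_pi_norm v' (r i))

/-- ★ **RIGHT INVERSE WITH ℓ²(HS) LETTER ALONG A SUB-DATUM** `𝔅 ≤ 𝔅'`: `√(Σ_b ‖H v' b‖²) ≤ B‖v'‖` on `𝔅'` (big chart differentiable at `0`; no sign condition on `B`) ⟹ a right inverse of the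
small derivative with `√(Σ_b ‖H' v b‖²) ≤ B‖v‖` (`H' v := H v'`, `v'` the extension of `v` by zero along the row map, `‖v'‖ = ‖v‖`).
[cite: Balaban1985Variational, Sect. C (44)–(48) p.285; Balaban1988Convergent, (2.10)–(2.12) p.256] -/
theorem exists_rightInverse_l2_of_le (hle : ∀ j, 𝔅 j ⊆ 𝔅' j) (hd : DifferentiableAt ℝ (msChartB F N K k 𝔅' W U) 0) {B : ℝ}
    {H : (Fin (constrCardB 𝔅' k) → lieSU (Fin N)) → PBond (F.P K) 0 → lieSU (Fin N)}
    (hH : ∀ v', fderiv ℝ (msChartB F N K k 𝔅' W U) 0 (H v') = v') (hHB : ∀ v', Real.sqrt (∑ b, ‖H v' b‖ ^ 2) ≤ B * ‖v'‖) :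
    ∃ H' : (Fin (constrCardB 𝔅 k) → lieSU (Fin N)) → PBond (F.P K) 0 → lieSU (Fin N),
      (∀ v, fderiv ℝ (msChartB F N K k 𝔅 W U) 0 (H' v) = v) ∧ ∀ v, Real.sqrt (∑ b, ‖H' v b‖ ^ 2) ≤ B * ‖v‖ := by
  obtain ⟨r, hrinj, hr⟩ := exists_rowMap_of_le (k := k) hle
  obtain ⟨H', hH', hlet⟩ := exists_rightInverse_of_rowMap hrinj hr hd hH
  refine ⟨H', hH', fun v => ?_⟩
  obtain ⟨v', hv', hvr, -, hn, -⟩ := hlet v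
  rw [hv', ← norm_eq_of_extension hvr hn]
  exact hHB v'

/-- ★ **RIGHT INVERSE WITH SUP AND ℓ²(HS) LETTERS** (`‖H v'‖ ≤ B‖v'‖`, `√(Σ_b ‖H v' b‖²) ≤ B₂‖v'‖` — the pair of `…DirectSurjHsurjUniformB`; no sign conditions): both pass to the sub-datum.
[cite: Balaban1985Variational, Sect. C (44)–(48) p.285; Balaban1988Convergent, (2.10)–(2.12) p.256] -/
theorem exists_rightInverse_sup_l2_of_le (hle : ∀ j, 𝔅 j ⊆ 𝔅' j) (hd : DifferentiableAt ℝ (msChartB F N K k 𝔅' W U) 0) {B B₂ : ℝ}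
    {H : (Fin (constrCardB 𝔅' k) → lieSU (Fin N)) → PBond (F.P K) 0 → lieSU (Fin N)}
    (hH : ∀ v', fderiv ℝ (msChartB F N K k 𝔅' W U) 0 (H v') = v') (hHB : ∀ v', ‖H v'‖ ≤ B * ‖v'‖)
    (hHB₂ : ∀ v', Real.sqrt (∑ b, ‖H v' b‖ ^ 2) ≤ B₂ * ‖v'‖) :
    ∃ H' : (Fin (constrCardB 𝔅 k) → lieSU (Fin N)) → PBond (F.P K) 0 → lieSU (Fin N),
      (∀ v, fderiv ℝ (msChartB F N K k 𝔅 W U) 0 (H' v) = v) ∧ (∀ v, ‖H' v‖ ≤ B * ‖v‖) ∧ ∀ v, Real.sqrt (∑ b, ‖H' v b‖ ^ 2) ≤ B₂ * ‖v‖ := by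
  obtain ⟨r, hrinj, hr⟩ := exists_rowMap_of_le (k := k) hle
  obtain ⟨H', hH', hlet⟩ := exists_rightInverse_of_rowMap hrinj hr hd hH
  refine ⟨H', hH', fun v => ?_, fun v => ?_⟩
  · obtain ⟨v', hv', hvr, -, hn, -⟩ := hlet v
    rw [hv', ← norm_eq_of_extension hvr hn]
    exact hHB v'
  · obtain ⟨v', hv', hvr, -, hn, -⟩ := hlet v
    rw [hv', ← norm_eq_of_extension hvr hn]
    exact hHB₂ v'

end Transfer

/-- **PRINT ≤ (b), ANY SEQUENCE `Ω`**: at a base point where the (b)-chart `msChart … (genSet Ω k) W U₀` is differentiable at `0`, a right inverse of its derivative with the ℓ²(HS) letter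
yields one of `D(msChartB … (lamBondsSeq Ω k) W U₀)(0)` with the same letter (`lamBondsSeq Ω k ≤ bondsDet (genSet Ω k)`, F0a; `msChart … (genSet Ω k) = msChartB … (bondsDet (genSet Ω k))`, `rfl`).
[cite: Balaban1984PropagatorsII, (2.3) p.224; Balaban1985Variational, Sect. C (44)–(48) p.285; Balaban1988Convergent, (2.10)–(2.12) p.256] -/
theorem exists_rightInverse_l2_lamBondsSeq_of_genSet {Ω : ℕ → Set (Site (F.P K) 0)} {W : MSField (F.P K) (SU N)} {U₀ : GaugeField (F.P K) 0 (SU N)}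
    (hd : DifferentiableAt ℝ (msChart F N K k (genSet Ω k) W U₀) 0) {B : ℝ}
    {H : (Fin (constrCard (genSet Ω k) k) → lieSU (Fin N)) → PBond (F.P K) 0 → lieSU (Fin N)}
    (hH : ∀ v, fderiv ℝ (msChart F N K k (genSet Ω k) W U₀) 0 (H v) = v) (hHB : ∀ v, Real.sqrt (∑ b, ‖H v b‖ ^ 2) ≤ B * ‖v‖) :
    ∃ H' : (Fin (constrCardB (lamBondsSeq Ω k) k) → lieSU (Fin N)) → PBond (F.P K) 0 → lieSU (Fin N),
      (∀ v, fderiv ℝ (msChartB F N K k (lamBondsSeq Ω k) W U₀) 0 (H' v) = v) ∧ ∀ v, Real.sqrt (∑ b, ‖H' v b‖ ^ 2) ≤ B * ‖v‖ :=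
  exists_rightInverse_l2_of_le (𝔅' := bondsDet (genSet Ω k)) (lamBondsSeq_subset_bondsDet Ω k) hd hH hHB

/-! ## §2  Datum bookkeeping: print's chart reads the datum on print's bonds only; a print-fibre base point is a (b)-fibre base point of a spliced datum -/

section Datum

variable {𝔅 : BDetSet (F.P K)} {W W' : MSField (F.P K) (SU N)} {U : GaugeField (F.P K) 0 (SU N)}

/-- `msChartB … 𝔅 W U` reads `W` ONLY on the bonds of `𝔅` (levels `≤ k`): two data agreeing there have the same chart. [cite: Balaban1985Variational, (82)–(83) p.290 (bookkeeping)] -/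
theorem msChartB_congr_datum (h : ∀ j ≤ k, ∀ c ∈ 𝔅 j, W' j c = W j c) : msChartB F N K k 𝔅 W' U = msChartB F N K k 𝔅 W U := by
  funext X i
  rw [msChartB_apply, msChartB_apply, relAvg, relAvg,
    h _ (Nat.le_of_lt_succ ((constrEnumB 𝔅 k).symm i).1.2) _ ((constrEnumB 𝔅 k).symm i).2.2]

/-- **A PRINT-FIBRE BASE POINT IS A (b)-FIBRE BASE POINT OF A SPLICED DATUM**: if `M˙U₀` agrees with `W` on print's bonds `lamBondsSeq Ω k`, then the datum `W'` («`W` on print's bonds, `M˙U₀`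
elsewhere») has `U₀` on its (b)-fibre `AgreeOn (genSet Ω k) (M˙U₀) W'` and agrees with `W` on print's bonds. [cite: Balaban1984PropagatorsII, (2.3) p.224; Balaban1988Convergent, (2.10) p.256] -/
theorem exists_datum_agreeOn_of_agreeOnB {Ω : ℕ → Set (Site (F.P K) 0)} {U₀ : GaugeField (F.P K) 0 (SU N)}
    (hW : AgreeOnB (lamBondsSeq Ω k) (avgFamily (avOfRecord F N K) U₀) W) :
    ∃ W' : MSField (F.P K) (SU N), AgreeOn (genSet Ω k) (avgFamily (avOfRecord F N K) U₀) W' ∧ ∀ j, ∀ c ∈ lamBondsSeq Ω k j, W' j c = W j c := by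
  classical
  refine ⟨fun j c => if c ∈ lamBondsSeq Ω k j then W j c else avgFamily (avOfRecord F N K) U₀ j c, fun j c _ => ?_, fun j c hc => by simp only [hc, if_true]⟩
  by_cases hc : c ∈ lamBondsSeq Ω k j
  · simp only [hc, if_true]
    exact hW j c hc
  · simp only [hc, if_false]

end Datum

/-! ## §3  THE SOCKET: p678596 at print's datum -/

section Record

set_option maxHeartbeats 400000 in
/-- ★★★ **(P4)′ (PROXIES EDITION) AT PRINT's DATUM — L2ᴮ's SOCKET AS NAMED.**  `…DirectSurjHsurjProxies.exists_rightInverse_letter_of_proxies` binder-for-binder (`∃ ε > 0` per height;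
per instance `M₁ ≥ 1`, `Z`, (2.13)'s divisibility, `∃ B ≥ 0`; per base point `W`, `U₀`: the (b)-fibre row `AgreeOn (Bj M₁ Z k) (M˙U₀) W`, one guarded proxy per (b)-row agreeing with `U₀`
on its `feeds`, one guarded proxy per inner `j`-site agreeing with `U₀` on the sharp towers of the rows touching it, the box-plaquette letter at `ε`) with the CONCLUSION over PRINT's chart:
a right inverse `H` of `D(msChartB F N K k (lamBondsSeq (maxDomT M₁ Z) k) W U₀)(0)` on `𝔰𝔲(N)^{#print rows}` with `√(Σ_b ‖H v b‖²) ≤ B‖v‖`.  SAME `ε`, SAME `B` as the (b)-socket.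
Proof: the (b)-socket's `H` restricted along the row map of `lamBondsSeq ≤ bondsDet (genSet …)`; differentiability of the (b)-chart at the base point from the tower proxies;
`Bj M₁ Z k = genSet (maxDomT M₁ Z) k` and `msChart = msChartB ∘ bondsDet` are `rfl`.
[cite: Balaban1984PropagatorsII, (2.3) p.224; Balaban1985Variational, Sect. C (44)–(48) p.285, (82)–(83) p.290, (153) p.301; Balaban1988Convergent, (2.2) p.255, (2.10)–(2.13) pp.256–257; Balaban1989LargeFieldII, Prop. 1 p.194] -/
theorem exists_rightInverse_letter_of_proxies (hkK : k + 1 ≤ (F.P K).m + (F.P K).K) :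
    ∃ ε : ℝ, 0 < ε ∧ ∀ (M₁ : ℕ) (_ : 1 ≤ M₁) (Z : Set (Site (F.P K) 0)) (_ : side (F.P K).L M₁ k ∣ (F.P K).sitesPerDir 0),
      ∃ B : ℝ, 0 ≤ B ∧ ∀ (W : MSField (F.P K) (SU N)) (U₀ : GaugeField (F.P K) 0 (SU N)),
        AgreeOn (Bj M₁ Z k) (avgFamily (avOfRecord F N K) U₀) W →
        (∀ i : Fin (constrCard (Bj M₁ Z k) k), ∃ U' : GaugeField (F.P K) 0 (SU N),
          (∀ b ∈ feeds (((constrEnum (Bj M₁ Z k) k).symm i).1 : ℕ) ((constrEnum (Bj M₁ Z k) k).symm i).2.1, U' b = U₀ b) ∧ SmallBelow (avOfRecord F N K) k U') →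
        (∀ (j : ℕ), 1 ≤ j → j ≤ k → ∀ y : Site (F.P K) j, embIter j y ∈ maxDomT M₁ Z j → ∃ U' : GaugeField (F.P K) 0 (SU N),
          (∀ c : PBond (F.P K) j, (c.src = y ∨ c.tgt = y) → ∀ b₀ : PBond (F.P K) 0,
            (iterBlockOf j b₀.src = c.src ∨ iterBlockOf j b₀.src = c.tgt) → (iterBlockOf j b₀.tgt = c.src ∨ iterBlockOf j b₀.tgt = c.tgt) → U' b₀ = U₀ b₀) ∧
          SmallBelow (avOfRecord F N K) k U') →
        (∀ (j : ℕ), 1 ≤ j → j ≤ k → ∀ y : Site (F.P K) j, embIter j y ∈ maxDomT M₁ Z j →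
          PlaqSmallOn (boxPlaqs (P := F.P K) (j := 0)
            (fun κ => lift (F.P K) (embIter j y) κ - ((((F.P K).L ^ j : ℕ) : ℤ) + ((((F.P K).L ^ j - 1) / 2 : ℕ) : ℤ)))
            (fun κ => lift (F.P K) (embIter j y) κ + ((((F.P K).L ^ j : ℕ) : ℤ) + ((((F.P K).L ^ j - 1) / 2 : ℕ) : ℤ)))) ε U₀) →
        ∃ H : (Fin (constrCardB (lamBondsSeq (maxDomT M₁ Z) k) k) → lieSU (Fin N)) → PBond (F.P K) 0 → lieSU (Fin N),
          (∀ v, fderiv ℝ (msChartB F N K k (lamBondsSeq (maxDomT M₁ Z) k) W U₀) 0 (H v) = v) ∧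
          ∀ v, Real.sqrt (∑ b, ‖H v b‖ ^ 2) ≤ B * ‖v‖ := by
  obtain ⟨ε, hε, h⟩ := N12DirectSurjHsurjProxies.exists_rightInverse_letter_of_proxies (F := F) (N := N) (K := K) (k := k) hkK
  refine ⟨ε, hε, fun M₁ hM₁ Z hdiv => ?_⟩
  obtain ⟨B, hB0, hB⟩ := h M₁ hM₁ Z hdiv
  refine ⟨B, hB0, fun W U₀ hU hprox hproxSite hplaq => ?_⟩
  obtain ⟨H, hH, hHB⟩ := hB W U₀ hU hprox hproxSite hplaq
  have hd : DifferentiableAt ℝ (msChart F N K k (Bj M₁ Z k) W U₀) 0 :=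
    differentiableAt_msChart_of_towerProxies (Nat.le_of_succ_le hkK) hU hprox
  exact exists_rightInverse_l2_lamBondsSeq_of_genSet (Ω := maxDomT M₁ Z) hd hH hHB

/-! ## §4  The print-fibre edition -/

set_option maxHeartbeats 400000 in
/-- ★★★ **(P4)′ AT PRINT's DATUM, PRINT-FIBRE BASE POINT.**  §3 with the base-point row in PRINT currency — `AgreeOnB (lamBondsSeq (maxDomT M₁ Z) k) (M˙U₀) W` (what a print minimiser
`IsMinimizerB … (lamBondsSeq (maxDomT M₁ Z) k) W U₀` delivers by `IsMinimizerB.agreeOnB`) in place of the (b)-fibre row; every other binder and the conclusion verbatim; SAME `ε`, SAME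
`B`.  Proof: splice the datum (`W' := W` on print's bonds, `M˙U₀` elsewhere — a (b)-fibre base point, §2), apply §3 at `W'` (the proxies and the plaquette letter do not read the datum),
and `msChartB … W' U₀ = msChartB … W U₀` (`msChartB_congr_datum`).
[cite: Balaban1984PropagatorsII, (2.3) p.224; Balaban1985Variational, Sect. C (44)–(48) p.285, (82)–(83) p.290; Balaban1988Convergent, (2.2) p.255, (2.10)–(2.13) pp.256–257; Balaban1989LargeFieldII, Prop. 1 p.194] -/
theorem exists_rightInverse_letter_of_proxies_of_agreeOnB (hkK : k + 1 ≤ (F.P K).m + (F.P K).K) :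
    ∃ ε : ℝ, 0 < ε ∧ ∀ (M₁ : ℕ) (_ : 1 ≤ M₁) (Z : Set (Site (F.P K) 0)) (_ : side (F.P K).L M₁ k ∣ (F.P K).sitesPerDir 0),
      ∃ B : ℝ, 0 ≤ B ∧ ∀ (W : MSField (F.P K) (SU N)) (U₀ : GaugeField (F.P K) 0 (SU N)),
        AgreeOnB (lamBondsSeq (maxDomT M₁ Z) k) (avgFamily (avOfRecord F N K) U₀) W →
        (∀ i : Fin (constrCard (Bj M₁ Z k) k), ∃ U' : GaugeField (F.P K) 0 (SU N),
          (∀ b ∈ feeds (((constrEnum (Bj M₁ Z k) k).symm i).1 : ℕ) ((constrEnum (Bj M₁ Z k) k).symm i).2.1, U' b = U₀ b) ∧ SmallBelow (avOfRecord F N K) k U') →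
        (∀ (j : ℕ), 1 ≤ j → j ≤ k → ∀ y : Site (F.P K) j, embIter j y ∈ maxDomT M₁ Z j → ∃ U' : GaugeField (F.P K) 0 (SU N),
          (∀ c : PBond (F.P K) j, (c.src = y ∨ c.tgt = y) → ∀ b₀ : PBond (F.P K) 0,
            (iterBlockOf j b₀.src = c.src ∨ iterBlockOf j b₀.src = c.tgt) → (iterBlockOf j b₀.tgt = c.src ∨ iterBlockOf j b₀.tgt = c.tgt) → U' b₀ = U₀ b₀) ∧
          SmallBelow (avOfRecord F N K) k U') →
        (∀ (j : ℕ), 1 ≤ j → j ≤ k → ∀ y : Site (F.P K) j, embIter j y ∈ maxDomT M₁ Z j →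
          PlaqSmallOn (boxPlaqs (P := F.P K) (j := 0)
            (fun κ => lift (F.P K) (embIter j y) κ - ((((F.P K).L ^ j : ℕ) : ℤ) + ((((F.P K).L ^ j - 1) / 2 : ℕ) : ℤ)))
            (fun κ => lift (F.P K) (embIter j y) κ + ((((F.P K).L ^ j : ℕ) : ℤ) + ((((F.P K).L ^ j - 1) / 2 : ℕ) : ℤ)))) ε U₀) →
        ∃ H : (Fin (constrCardB (lamBondsSeq (maxDomT M₁ Z) k) k) → lieSU (Fin N)) → PBond (F.P K) 0 → lieSU (Fin N),
          (∀ v, fderiv ℝ (msChartB F N K k (lamBondsSeq (maxDomT M₁ Z) k) W U₀) 0 (H v) = v) ∧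
          ∀ v, Real.sqrt (∑ b, ‖H v b‖ ^ 2) ≤ B * ‖v‖ := by
  obtain ⟨ε, hε, h⟩ := exists_rightInverse_letter_of_proxies (F := F) (N := N) (K := K) (k := k) hkK
  refine ⟨ε, hε, fun M₁ hM₁ Z hdiv => ?_⟩
  obtain ⟨B, hB0, hB⟩ := h M₁ hM₁ Z hdiv
  refine ⟨B, hB0, fun W U₀ hW hprox hproxSite hplaq => ?_⟩
  obtain ⟨W', hU', hW'⟩ := exists_datum_agreeOn_of_agreeOnB (F := F) (N := N) (K := K) (k := k) (Ω := maxDomT M₁ Z) hW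
  obtain ⟨H, hH, hHB⟩ := hB W' U₀ hU' hprox hproxSite hplaq
  refine ⟨H, fun v => ?_, hHB⟩
  rw [← msChartB_congr_datum (W' := W') (W := W) fun j _ c hc => hW' j c hc]
  exact hH v

end Record

end Summit.QuantumFields.YangMills.BalabanUVNodes.N12DirectSurjHsurjProxiesLam
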